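import Literature.MathematicalPhysics.QuantumLattice.HubbardTTPrimeTwoColumnCapTransport
import Literature.MathematicalPhysics.QuantumLattice.HubbardTTPrimeTwoColumnCaps
import HarnessLib

/-!
# Cap-class certificate transport on a `(t', U)` CELL from the caps of its TOP CORNERS
# (the joint form of the far-column rule; the `U`-extent above the anchor row is free)

Family `hubbard` (topic `MathematicalPhysics/QuantumLattice`); written for stage S2
"certifier-families" of the Hubbard material-oracle programme, seat `hubbard-box-p3`; the joint
`(t', U)` companion of `HubbardTTPrimeTwoColumnCapTransport` (the `t'`-cell at fixed `U`) and of
`HubbardTTPrimeJointCapTransport` (ONE anchor `(s₀, U₀)`: booking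
`u₀ + |s − s₀|(A_K − B_K) + |U − U₀|(A_D − B_D)`). Notation as there:
`e(t,t',U,n) = energyDensityTT' t t' U n`; `Φ(t,t',U) = hubbardTTPrimeFermionInteraction t t' U`;
`e_Φ(ω) = ω.meanEnergy Φ 1`; `K₂(ω) = e_{Φ(0,1,0)}(ω)`; `D(ω) = e_{Φ(0,0,1)}(ω)` (double occupancy per
site); "torus-limit ground state at `(t,s,U)`, density `n`" as in all transport files.

THE POINT. For a torus-limit ground state `ω` at a point `(s, U)` of a cell and an anchor `(s₀, U₀)`,
linearity gives `e_{Φ(t,s₀,U₀)}(ω) = e(t,s,U,n) + (U₀ − U)·D(ω) + (s₀ − s)·K₂(ω)`. Three monotone facts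
price the three terms WITHOUT any data at the anchor: `e(t,s,U,n) ≤ e(t,s,U₂,n)` for `U ≤ U₂`
(`energyDensityTT'_mono_U`), so the TOP EDGE carries the energy and the two top corners' caps and
`K₂` words cap it by the two tangents of `HubbardTTPrimeTwoColumnCaps`; `D(ω) ≥ 0`, so ABOVE the
anchor row (`U ≥ U₀`) the `U`-displacement costs nothing, and below it at most `(U₀ − U₁)` times a
double-occupancy ceiling (`(n/2)²` for repulsive ground states, or a rectangle word); `K₂(ω)` is priced
by a rectangle-uniform window (the kinematic `|K₂| ≤ 16/π²`, or the words of
`HubbardTTPrimeJointCapTransport` §3).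

* §1 the `U`-segment above the anchor: `IsTorusLimitOf.meanEnergy_anchor_le_of_upperCap_U` — for
  `U₀ ≤ U ≤ U₂` every torus-limit ground state `ω` at `(t,s,U)` has `e_{Φ(t,s,U₀)}(ω) ≤ R` as soon as
  `e(t,s,U₂,n) ≤ R`: ONE cap at the top of the segment books every cap-class certificate at its
  bottom for the whole segment (`forall_groundState_U_segment_of_forall_cap_upperCap`).
* §2 word-free cell rule `IsTorusLimitOf.meanEnergy_anchor₂_le_of_topCaps_kinematic`: rectangle
  `[s₁,s₂] × [U₁,U₂]` (`U₁ > 0`), anchor row `U₀ ∈ [U₁,U₂]` (any `s₀`), caps `R₁`, `R₂` at the top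
  corners `(s₁,U₂)`, `(s₂,U₂)`: `e_{Φ(t,s₀,U₀)}(ω) ≤ max (R₁ + (16/π²)(s₀ − s₁)) (R₂ + (16/π²)(s₂ − s₀))
  + (U₀ − U₁)(n/2)²` for every torus-limit ground state in the cell; BOX ⇒ WORD
  `forall_groundState_tPrime_U_cell_of_forall_cap_topCaps_kinematic`.
* §3 word form `IsTorusLimitOf.meanEnergy_anchor₂_le_of_topCorners`: ceiling word `A₁` at `(s₁,U₂)`,
  floor word `B₂` at `(s₂,U₂)`, rectangle-uniform windows `K₂ ∈ [B_K, A_K]`, `D ∈ [B_D, A_D]` (the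
  hypothesis shape of `IsTorusLimitOf.meanEnergy_anchor₂_le_of_rectWords`):
  `≤ max (R₁ + (s₀ − s₁)·max A₁ A_K) (R₂ − (s₂ − s₀)·min B₂ B_K) + (U₀ − U₁)·max A_D 0`; BOX ⇒ WORD
  `forall_groundState_tPrime_U_cell_of_forall_cap_topCorners`.

Against the one-anchor booking the top corners' certified caps replace the anchor cap plus its own
tangent; with the anchor on the BOTTOM edge (`U₀ = U₁`) the `U`-term vanishes altogether. HONEST
FRAMING: bookkeeping of linearity, monotonicity in `U`, `D ≥ 0`, the Hellmann–Feynman tangents and the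
antitonicity of `K₂`; no number is produced here, every cap and word is a hypothesis to be discharged by
a certified row, and nothing here bears on superconductivity by itself. Everything is PROVED; no
definition, no named fact, no numerical input.

## Mathlib / tree search

REUSED: `InfVolFermionState.meanEnergy_hubbardTTPrime_affine`,
`IsTorusLimitOf.meanEnergy_hubbardTTPrime_eq_energyDensityTT'`, `energyDensityTT'_mono_U`,
`IsTorusLimitOf.docc_nonneg`, `IsTorusLimitOf.docc_le_sq_half_density_of_groundState`,
`IsTorusLimitOf.abs_meanEnergy_diagHop_le`, `energyDensityTT'_le_of_upperBound_tPrime_kinematic`,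
`energyDensityTT'_sub_le_mul_of_forall_diagHop_le`, `mul_le_energyDensityTT'_sub_of_forall_le_diagHop`,
`mem_szSector_iff`. `lean search 'topCaps|topCorners|upperCap_U|U_cell_of_forall_cap'` in
`Literature/`: no prior statement (`HubbardTTPrimeJointCapTransport` is the one-anchor form).

## References

* T. Koma, H. Tasaki, J. Stat. Phys. 76 (1994) 745, §1 (joint concavity in the couplings; the
  conjugate observables are supergradients; `∂E/∂U = ⟨D⟩ ≥ 0`). [cite: KomaTasaki1994, §1]
* R. B. Griffiths, Phys. Rev. 152 (1966) 240, §II (monotonicity of conjugate expectations in the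
  coupling). [cite: Griffiths1966, §II]
* J. Wang et al., Phys. Rev. X 14 (2024) 031006, §III (a relaxation certificate constrains every state
  below an energy cap). [cite: WangEtAl2024, §III]
* V. Bach, E. H. Lieb, J. P. Solovej, J. Stat. Phys. 76 (1994) 3, eq. (2c.36) (Hartree–Fock states are
  variational: `D ≤ (n/2)²` in repulsive ground states). [cite: BachLiebSolovej1994, eq. (2c.36)]
* E. H. Lieb, M. Loss, Duke Math. J. 71 (1993) 337, §8 Thm. 8.2 (`|K₂| ≤ 16/π²`).
  [cite: LiebLoss1993, §8, Theorem 8.2]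
-/

noncomputable section

namespace Literature.MathematicalPhysics.QuantumLattice

open Matrix Finset HubbardWave0 Literature.Probability.LatticeModels ThermodynamicLimit
open _root_.Filter
open scoped _root_.Topology ComplexOrder BigOperators

namespace InfVolFermionState

/-! ### §1 The `U`-segment above the anchor: one cap at the top books the whole segment -/

/-- **Anchor energy on the `U`-segment above the anchor.** For `0 ≤ U₀ ≤ U ≤ U₂` (same `t`, `s`,
density `0 ≤ n < 2`) and a certified cap `e(t,s,U₂,n) ≤ R` at the TOP of the segment, every torus-limit
ground state `ω` at `(t,s,U)` has `e_{Φ(t,s,U₀)}(ω) ≤ R`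
(`e_{Φ(t,s,U₀)}(ω) = e(t,s,U,n) + (U₀ − U)D(ω) ≤ e(t,s,U,n) ≤ e(t,s,U₂,n)`: `D ≥ 0` and `e` is
non-decreasing in `U`). [cite: KomaTasaki1994, §1] [cite: Griffiths1966, §II] -/
theorem IsTorusLimitOf.meanEnergy_anchor_le_of_upperCap_U (t s : ℝ) {U₀ U U₂ : ℝ} (hU₀ : 0 ≤ U₀)
    (h0U : U₀ ≤ U) (hU2 : U ≤ U₂) {n : ℝ} (hn0 : 0 ≤ n) (hn2 : n < 2) {R : ℝ}
    (hR : energyDensityTT' t s U₂ n ≤ R)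
    {ω : InfVolFermionState 2} {ψ : ∀ L, Fock (Orb (FermionTorus 2 L))} {Ls : ℕ → ℕ}
    (h : ω.IsTorusLimitOf ψ Ls) (hLs : Tendsto Ls atTop atTop)
    (hψ : ∀ j, IsGroundStateInSector (hubbardTorusTT' (Ls j) t s U) (rectN n (Ls j)) 0 (ψ (Ls j)))
    (h1 : ∀ j, star (ψ (Ls j)) ⬝ᵥ ψ (Ls j) = 1) :
    ω.meanEnergy (hubbardTTPrimeFermionInteraction t s U₀) 1 ≤ R := by
  have hU : 0 ≤ U := hU₀.trans h0U
  have haff := ω.meanEnergy_hubbardTTPrime_affine t s U s U₀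
  have hgs := h.meanEnergy_hubbardTTPrime_eq_energyDensityTT' t s hU hn0 hn2 hLs hψ h1
  have hmono := energyDensityTT'_mono_U t s hn0 hn2 hU hU2
  have hD0 := h.docc_nonneg hLs
  have hDterm := mul_le_mul_of_nonpos_left hD0 (sub_nonpos.2 h0U)
  rw [mul_zero] at hDterm
  rw [haff, hgs, sub_self, zero_mul, add_zero]
  linarith

/-- **BOX ⇒ WORD on the `U`-segment above the anchor.** A property `P` holding for every torus limit
(along some `Ls → ∞`) of unit `rectN n`-vectors with `e_{Φ(t,s,U₀)} ≤ u` (a cap-class certificate at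
`(s, U₀)`, `U₀ ≥ 0`) holds for every torus-limit ground state at every `U ∈ [U₀, U₂]` (same `t, s, n`) as
soon as `e(t,s,U₂,n) ≤ u`. [cite: WangEtAl2024, §III] [cite: KomaTasaki1994, §1] -/
theorem forall_groundState_U_segment_of_forall_cap_upperCap (t s : ℝ) {U₀ U₂ : ℝ} (hU₀ : 0 ≤ U₀)
    {n : ℝ} (hn0 : 0 ≤ n) (hn2 : n < 2) {u : ℝ} (hu : energyDensityTT' t s U₂ n ≤ u)
    {P : InfVolFermionState 2 → Prop}
    (hP : ∀ (ω : InfVolFermionState 2) (Ls : ℕ → ℕ) (ψ : ∀ L, Fock (Orb (FermionTorus 2 L))),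
      Tendsto Ls atTop atTop → (∀ j, IsNParticle (rectN n (Ls j)) (ψ (Ls j))) →
      (∀ j, star (ψ (Ls j)) ⬝ᵥ ψ (Ls j) = 1) → ω.IsTorusLimitOf ψ Ls →
      ω.meanEnergy (hubbardTTPrimeFermionInteraction t s U₀) 1 ≤ u → P ω)
    {U : ℝ} (hUm : U ∈ Set.Icc U₀ U₂)
    {ω : InfVolFermionState 2} {ψ : ∀ L, Fock (Orb (FermionTorus 2 L))} {Ls : ℕ → ℕ}
    (h : ω.IsTorusLimitOf ψ Ls) (hLs : Tendsto Ls atTop atTop)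
    (hψ : ∀ j, IsGroundStateInSector (hubbardTorusTT' (Ls j) t s U) (rectN n (Ls j)) 0 (ψ (Ls j)))
    (h1 : ∀ j, star (ψ (Ls j)) ⬝ᵥ ψ (Ls j) = 1) : P ω := by
  have hN : ∀ j, IsNParticle (rectN n (Ls j)) (ψ (Ls j)) := fun j =>
    ((mem_szSector_iff _ _ _).1 (hψ j).1).1
  exact hP ω Ls ψ hLs hN h1 h
    (h.meanEnergy_anchor_le_of_upperCap_U t s hU₀ hUm.1 hUm.2 hn0 hn2 hu hLs hψ h1)

/-! ### §2 The cell from its two TOP-CORNER caps (kinematic `K₂` row, Hartree–Fock docc ceiling) -/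

/-- **Cell rule, word-free.** Rectangle `[s₁,s₂] × [U₁,U₂]` with `U₁ > 0`, density `0 ≤ n < 2`,
anchor row `U₀ ∈ [U₁,U₂]` and any anchor abscissa `s₀`; caps `e(t,s₁,U₂,n) ≤ R₁`, `e(t,s₂,U₂,n) ≤ R₂`
at the two TOP corners. Every torus-limit ground state `ω` at any `(s,U)` of the rectangle satisfies
`e_{Φ(t,s₀,U₀)}(ω) ≤ max (R₁ + (16/π²)(s₀ − s₁)) (R₂ + (16/π²)(s₂ − s₀)) + (U₀ − U₁)(n/2)²`
(top edge by monotonicity in `U` and kinematic cap transport along it, `(s₀ − s)K₂(ω) ≤ (16/π²)|s₀ − s|`,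
`(U₀ − U)D(ω) ≤ 0` above the anchor row and `≤ (U₀ − U)(n/2)²` below it). With the anchor on the
bottom edge the last term vanishes. [cite: KomaTasaki1994, §1] [cite: LiebLoss1993, §8, Theorem 8.2]
[cite: BachLiebSolovej1994, eq. (2c.36)] -/
theorem IsTorusLimitOf.meanEnergy_anchor₂_le_of_topCaps_kinematic (t : ℝ) {s₁ s₂ U₁ U₂ s₀ U₀ s U : ℝ}
    (hU₁ : 0 < U₁) (hU₀ : U₀ ∈ Set.Icc U₁ U₂) (hs : s ∈ Set.Icc s₁ s₂) (hUm : U ∈ Set.Icc U₁ U₂)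
    {n : ℝ} (hn0 : 0 ≤ n) (hn2 : n < 2) {R₁ R₂ : ℝ}
    (hR₁ : energyDensityTT' t s₁ U₂ n ≤ R₁) (hR₂ : energyDensityTT' t s₂ U₂ n ≤ R₂)
    {ω : InfVolFermionState 2} {ψ : ∀ L, Fock (Orb (FermionTorus 2 L))} {Ls : ℕ → ℕ}
    (h : ω.IsTorusLimitOf ψ Ls) (hLs : Tendsto Ls atTop atTop)
    (hψ : ∀ j, IsGroundStateInSector (hubbardTorusTT' (Ls j) t s U) (rectN n (Ls j)) 0 (ψ (Ls j)))
    (h1 : ∀ j, star (ψ (Ls j)) ⬝ᵥ ψ (Ls j) = 1) :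
    ω.meanEnergy (hubbardTTPrimeFermionInteraction t s₀ U₀) 1 ≤
      max (R₁ + 16 / Real.pi ^ 2 * (s₀ - s₁)) (R₂ + 16 / Real.pi ^ 2 * (s₂ - s₀)) +
        (U₀ - U₁) * (n / 2) ^ 2 := by
  have hUpos : 0 < U := hU₁.trans_le hUm.1
  have hU : 0 ≤ U := hUpos.le
  have hU₂ : 0 ≤ U₂ := hU.trans hUm.2
  have hN : ∀ j, IsNParticle (rectN n (Ls j)) (ψ (Ls j)) := fun j =>
    ((mem_szSector_iff _ _ _).1 (hψ j).1).1
  have haff := ω.meanEnergy_hubbardTTPrime_affine t s U s₀ U₀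
  have hgs := h.meanEnergy_hubbardTTPrime_eq_energyDensityTT' t s hU hn0 hn2 hLs hψ h1
  have hmono := energyDensityTT'_mono_U t s hn0 hn2 hU hUm.2
  have hK := abs_le.1 (h.abs_meanEnergy_diagHop_le hn0 hn2 hLs hN h1)
  have hD0 := h.docc_nonneg hLs
  have hDhi := h.docc_le_sq_half_density_of_groundState t s hUpos hn0 hn2 hLs hψ h1
  set D := ω.meanEnergy (hubbardTTPrimeFermionInteraction 0 0 1) 1 with hD_def
  set K := ω.meanEnergy (hubbardTTPrimeFermionInteraction 0 1 0) 1 with hK_def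
  set κ : ℝ := 16 / Real.pi ^ 2 with hκ_def
  -- the `U`-displacement term
  have hDterm : (U₀ - U) * D ≤ (U₀ - U₁) * (n / 2) ^ 2 := by
    have hq : 0 ≤ (n / 2) ^ 2 := sq_nonneg _
    rcases le_total U U₀ with hle | hge
    · have e₁ := mul_le_mul_of_nonneg_left hDhi (sub_nonneg.2 hle)
      have e₂ : (U₀ - U) * (n / 2) ^ 2 ≤ (U₀ - U₁) * (n / 2) ^ 2 :=
        mul_le_mul_of_nonneg_right (by linarith [hUm.1]) hq
      exact e₁.trans e₂
    · have e₁ := mul_le_mul_of_nonpos_left hD0 (sub_nonpos.2 hge)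
      rw [mul_zero] at e₁
      exact e₁.trans (mul_nonneg (sub_nonneg.2 hU₀.1) hq)
  have hM₁ := le_max_left (R₁ + κ * (s₀ - s₁)) (R₂ + κ * (s₂ - s₀))
  have hM₂ := le_max_right (R₁ + κ * (s₀ - s₁)) (R₂ + κ * (s₂ - s₀))
  rw [haff, hgs]
  rcases le_total s s₀ with hle | hge
  · -- left of the anchor: top-left corner
    have hcap := energyDensityTT'_le_of_upperBound_tPrime_kinematic t hU₂ hn0 hn2 (s' := s) hR₁
    rw [abs_of_nonneg (sub_nonneg.2 hs.1)] at hcap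
    have hKt := mul_le_mul_of_nonneg_left hK.2 (sub_nonneg.2 hle)
    have e : R₁ + κ * (s₀ - s₁) = R₁ + κ * (s - s₁) + (s₀ - s) * κ := by ring
    linarith
  · -- right of the anchor: top-right corner
    have hcap := energyDensityTT'_le_of_upperBound_tPrime_kinematic t hU₂ hn0 hn2 (s' := s) hR₂
    rw [abs_of_nonpos (sub_nonpos.2 hs.2)] at hcap
    have hKt := mul_le_mul_of_nonpos_left hK.1 (sub_nonpos.2 hge)
    have e : R₂ + κ * (s₂ - s₀) = R₂ + κ * (-(s - s₂)) + (s₀ - s) * (-κ) := by ring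
    linarith

/-- **BOX ⇒ WORD on the cell, word-free.** Same rectangle and top-corner caps; a property `P` holding
for every torus limit of unit `rectN n`-vectors with `e_{Φ(t,s₀,U₀)} ≤ u` (a cap-class certificate at the
anchor `(s₀, U₀)`, `U₀ ∈ [U₁,U₂]`) holds for every torus-limit ground state at every point of the
rectangle as soon as `max (R₁ + (16/π²)(s₀ − s₁)) (R₂ + (16/π²)(s₂ − s₀)) + (U₀ − U₁)(n/2)² ≤ u`.
[cite: WangEtAl2024, §III] [cite: KomaTasaki1994, §1] -/
theorem forall_groundState_tPrime_U_cell_of_forall_cap_topCaps_kinematic (t : ℝ)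
    {s₁ s₂ U₁ U₂ s₀ U₀ : ℝ} (hU₁ : 0 < U₁) (hU₀ : U₀ ∈ Set.Icc U₁ U₂) {n : ℝ} (hn0 : 0 ≤ n)
    (hn2 : n < 2) {R₁ R₂ u : ℝ}
    (hR₁ : energyDensityTT' t s₁ U₂ n ≤ R₁) (hR₂ : energyDensityTT' t s₂ U₂ n ≤ R₂)
    (hu : max (R₁ + 16 / Real.pi ^ 2 * (s₀ - s₁)) (R₂ + 16 / Real.pi ^ 2 * (s₂ - s₀)) +
      (U₀ - U₁) * (n / 2) ^ 2 ≤ u)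
    {P : InfVolFermionState 2 → Prop}
    (hP : ∀ (ω : InfVolFermionState 2) (Ls : ℕ → ℕ) (ψ : ∀ L, Fock (Orb (FermionTorus 2 L))),
      Tendsto Ls atTop atTop → (∀ j, IsNParticle (rectN n (Ls j)) (ψ (Ls j))) →
      (∀ j, star (ψ (Ls j)) ⬝ᵥ ψ (Ls j) = 1) → ω.IsTorusLimitOf ψ Ls →
      ω.meanEnergy (hubbardTTPrimeFermionInteraction t s₀ U₀) 1 ≤ u → P ω)
    {s U : ℝ} (hs : s ∈ Set.Icc s₁ s₂) (hUm : U ∈ Set.Icc U₁ U₂)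
    {ω : InfVolFermionState 2} {ψ : ∀ L, Fock (Orb (FermionTorus 2 L))} {Ls : ℕ → ℕ}
    (h : ω.IsTorusLimitOf ψ Ls) (hLs : Tendsto Ls atTop atTop)
    (hψ : ∀ j, IsGroundStateInSector (hubbardTorusTT' (Ls j) t s U) (rectN n (Ls j)) 0 (ψ (Ls j)))
    (h1 : ∀ j, star (ψ (Ls j)) ⬝ᵥ ψ (Ls j) = 1) : P ω := by
  have hN : ∀ j, IsNParticle (rectN n (Ls j)) (ψ (Ls j)) := fun j =>
    ((mem_szSector_iff _ _ _).1 (hψ j).1).1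
  exact hP ω Ls ψ hLs hN h1 h
    ((h.meanEnergy_anchor₂_le_of_topCaps_kinematic t hU₁ hU₀ hs hUm hn0 hn2 hR₁ hR₂ hLs hψ h1).trans
      hu)

/-! ### §3 The cell from its two top corners' caps AND words, with rectangle-uniform windows -/

/-- **Cell rule, word form.** Rectangle `[s₁,s₂] × [U₁,U₂]` (`U₁ ≥ 0`), density `0 ≤ n < 2`, anchor
row `U₀ ∈ [U₁,U₂]`, any anchor abscissa `s₀`; at the top corners: caps `R₁` at `(s₁,U₂)`, `R₂` at
`(s₂,U₂)`, a ceiling word `A₁` at `(s₁,U₂)` and a floor word `B₂` at `(s₂,U₂)`; rectangle-uniform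
ground-state windows `K₂ ∈ [B_K, A_K]` and `D ∈ [B_D, A_D]` (the hypotheses `hK`, `hD` of
`IsTorusLimitOf.meanEnergy_anchor₂_le_of_rectWords`). Every torus-limit ground state `ω` at any `(s,U)`
of the rectangle satisfies `e_{Φ(t,s₀,U₀)}(ω) ≤ max (R₁ + (s₀ − s₁)·max A₁ A_K) (R₂ − (s₂ − s₀)·min B₂ B_K)
+ (U₀ − U₁)·max A_D 0`. [cite: KomaTasaki1994, §1] [cite: Griffiths1966, §II] [cite: WangEtAl2024, §III] -/
theorem IsTorusLimitOf.meanEnergy_anchor₂_le_of_topCorners (t : ℝ) {s₁ s₂ U₁ U₂ s₀ U₀ s U : ℝ}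
    (hU₁ : 0 ≤ U₁) (hU₀ : U₀ ∈ Set.Icc U₁ U₂) (hs : s ∈ Set.Icc s₁ s₂) (hUm : U ∈ Set.Icc U₁ U₂)
    {n : ℝ} (hn0 : 0 ≤ n) (hn2 : n < 2) {R₁ R₂ A₁ B₂ AK BK AD BD : ℝ}
    (hR₁ : energyDensityTT' t s₁ U₂ n ≤ R₁) (hR₂ : energyDensityTT' t s₂ U₂ n ≤ R₂)
    (hA₁ : ∀ (ω₁ : InfVolFermionState 2) (Ls₁ : ℕ → ℕ) (ψ₁ : ∀ L, Fock (Orb (FermionTorus 2 L))),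
      Tendsto Ls₁ atTop atTop →
      (∀ j, IsGroundStateInSector (hubbardTorusTT' (Ls₁ j) t s₁ U₂) (rectN n (Ls₁ j)) 0 (ψ₁ (Ls₁ j))) →
      (∀ j, star (ψ₁ (Ls₁ j)) ⬝ᵥ ψ₁ (Ls₁ j) = 1) → ω₁.IsTorusLimitOf ψ₁ Ls₁ →
      ω₁.meanEnergy (hubbardTTPrimeFermionInteraction 0 1 0) 1 ≤ A₁)
    (hB₂ : ∀ (ω₂ : InfVolFermionState 2) (Ls₂ : ℕ → ℕ) (ψ₂ : ∀ L, Fock (Orb (FermionTorus 2 L))),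
      Tendsto Ls₂ atTop atTop →
      (∀ j, IsGroundStateInSector (hubbardTorusTT' (Ls₂ j) t s₂ U₂) (rectN n (Ls₂ j)) 0 (ψ₂ (Ls₂ j))) →
      (∀ j, star (ψ₂ (Ls₂ j)) ⬝ᵥ ψ₂ (Ls₂ j) = 1) → ω₂.IsTorusLimitOf ψ₂ Ls₂ →
      B₂ ≤ ω₂.meanEnergy (hubbardTTPrimeFermionInteraction 0 1 0) 1)
    (hK : ∀ (s' U' : ℝ), s' ∈ Set.Icc s₁ s₂ → U' ∈ Set.Icc U₁ U₂ →
      ∀ (ω' : InfVolFermionState 2) (Ls' : ℕ → ℕ) (ψ' : ∀ L, Fock (Orb (FermionTorus 2 L))),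
      Tendsto Ls' atTop atTop →
      (∀ j, IsGroundStateInSector (hubbardTorusTT' (Ls' j) t s' U') (rectN n (Ls' j)) 0 (ψ' (Ls' j))) →
      (∀ j, star (ψ' (Ls' j)) ⬝ᵥ ψ' (Ls' j) = 1) → ω'.IsTorusLimitOf ψ' Ls' →
      ω'.meanEnergy (hubbardTTPrimeFermionInteraction 0 1 0) 1 ∈ Set.Icc BK AK)
    (hD : ∀ (s' U' : ℝ), s' ∈ Set.Icc s₁ s₂ → U' ∈ Set.Icc U₁ U₂ →
      ∀ (ω' : InfVolFermionState 2) (Ls' : ℕ → ℕ) (ψ' : ∀ L, Fock (Orb (FermionTorus 2 L))),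
      Tendsto Ls' atTop atTop →
      (∀ j, IsGroundStateInSector (hubbardTorusTT' (Ls' j) t s' U') (rectN n (Ls' j)) 0 (ψ' (Ls' j))) →
      (∀ j, star (ψ' (Ls' j)) ⬝ᵥ ψ' (Ls' j) = 1) → ω'.IsTorusLimitOf ψ' Ls' →
      ω'.meanEnergy (hubbardTTPrimeFermionInteraction 0 0 1) 1 ∈ Set.Icc BD AD)
    {ω : InfVolFermionState 2} {ψ : ∀ L, Fock (Orb (FermionTorus 2 L))} {Ls : ℕ → ℕ}
    (h : ω.IsTorusLimitOf ψ Ls) (hLs : Tendsto Ls atTop atTop)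
    (hψ : ∀ j, IsGroundStateInSector (hubbardTorusTT' (Ls j) t s U) (rectN n (Ls j)) 0 (ψ (Ls j)))
    (h1 : ∀ j, star (ψ (Ls j)) ⬝ᵥ ψ (Ls j) = 1) :
    ω.meanEnergy (hubbardTTPrimeFermionInteraction t s₀ U₀) 1 ≤
      max (R₁ + (s₀ - s₁) * max A₁ AK) (R₂ - (s₂ - s₀) * min B₂ BK) + (U₀ - U₁) * max AD 0 := by
  have hU : 0 ≤ U := hU₁.trans hUm.1
  have hU₂ : 0 ≤ U₂ := hU.trans hUm.2
  have haff := ω.meanEnergy_hubbardTTPrime_affine t s U s₀ U₀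
  have hgs := h.meanEnergy_hubbardTTPrime_eq_energyDensityTT' t s hU hn0 hn2 hLs hψ h1
  have hmono := energyDensityTT'_mono_U t s hn0 hn2 hU hUm.2
  have hKω := hK s U hs hUm ω Ls ψ hLs hψ h1 h
  have hDω := hD s U hs hUm ω Ls ψ hLs hψ h1 h
  have hD0 := h.docc_nonneg hLs
  set D := ω.meanEnergy (hubbardTTPrimeFermionInteraction 0 0 1) 1 with hD_def
  set K := ω.meanEnergy (hubbardTTPrimeFermionInteraction 0 1 0) 1 with hK_def
  -- the `U`-displacement term
  have hAD := le_max_left AD 0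
  have hAD0 : 0 ≤ max AD 0 := le_max_right _ _
  have hDterm : (U₀ - U) * D ≤ (U₀ - U₁) * max AD 0 := by
    rcases le_total U U₀ with hle | hge
    · have e₁ := mul_le_mul_of_nonneg_left (hDω.2.trans hAD) (sub_nonneg.2 hle)
      have e₂ : (U₀ - U) * max AD 0 ≤ (U₀ - U₁) * max AD 0 :=
        mul_le_mul_of_nonneg_right (by linarith [hUm.1]) hAD0
      exact e₁.trans e₂
    · have e₁ := mul_le_mul_of_nonpos_left hD0 (sub_nonpos.2 hge)
      rw [mul_zero] at e₁
      exact e₁.trans (mul_nonneg (sub_nonneg.2 hU₀.1) hAD0)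
  have hM₁ := le_max_left (R₁ + (s₀ - s₁) * max A₁ AK) (R₂ - (s₂ - s₀) * min B₂ BK)
  have hM₂ := le_max_right (R₁ + (s₀ - s₁) * max A₁ AK) (R₂ - (s₂ - s₀) * min B₂ BK)
  rw [haff, hgs]
  rcases le_total s s₀ with hle | hge
  · -- left of the anchor: top-left corner's tangent along the top edge, ceiling on `K₂`
    have hup := energyDensityTT'_sub_le_mul_of_forall_diagHop_le t (le_refl s₁) hs.1 hU₂ hn0 hn2 hA₁
    have e₁ : A₁ * (s - s₁) ≤ max A₁ AK * (s - s₁) :=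
      mul_le_mul_of_nonneg_right (le_max_left _ _) (sub_nonneg.2 hs.1)
    have hKt := mul_le_mul_of_nonneg_left (hKω.2.trans (le_max_right A₁ AK)) (sub_nonneg.2 hle)
    have e : R₁ + (s₀ - s₁) * max A₁ AK = R₁ + max A₁ AK * (s - s₁) + (s₀ - s) * max A₁ AK := by
      ring
    linarith
  · -- right of the anchor: top-right corner's tangent along the top edge, floor on `K₂`
    have hdn := mul_le_energyDensityTT'_sub_of_forall_le_diagHop t hs.2 (le_refl s₂) hU₂ hn0 hn2 hB₂
    have e₁ : min B₂ BK * (s₂ - s) ≤ B₂ * (s₂ - s) :=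
      mul_le_mul_of_nonneg_right (min_le_left _ _) (sub_nonneg.2 hs.2)
    have hKt := mul_le_mul_of_nonpos_left ((min_le_right B₂ BK).trans hKω.1) (sub_nonpos.2 hge)
    have e : R₂ - (s₂ - s₀) * min B₂ BK = R₂ - min B₂ BK * (s₂ - s) + (s₀ - s) * min B₂ BK := by
      ring
    linarith

/-- **BOX ⇒ WORD on the cell, word form.** Same data; a cap-class property `P` certified at the
anchor `(s₀, U₀)` for the cap `u` holds for every torus-limit ground state at every point of the
rectangle as soon as
`max (R₁ + (s₀ − s₁)·max A₁ A_K) (R₂ − (s₂ − s₀)·min B₂ B_K) + (U₀ − U₁)·max A_D 0 ≤ u`.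
[cite: WangEtAl2024, §III] [cite: KomaTasaki1994, §1] -/
theorem forall_groundState_tPrime_U_cell_of_forall_cap_topCorners (t : ℝ)
    {s₁ s₂ U₁ U₂ s₀ U₀ : ℝ} (hU₁ : 0 ≤ U₁) (hU₀ : U₀ ∈ Set.Icc U₁ U₂) {n : ℝ} (hn0 : 0 ≤ n)
    (hn2 : n < 2) {R₁ R₂ A₁ B₂ AK BK AD BD u : ℝ}
    (hR₁ : energyDensityTT' t s₁ U₂ n ≤ R₁) (hR₂ : energyDensityTT' t s₂ U₂ n ≤ R₂)
    (hA₁ : ∀ (ω₁ : InfVolFermionState 2) (Ls₁ : ℕ → ℕ) (ψ₁ : ∀ L, Fock (Orb (FermionTorus 2 L))),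
      Tendsto Ls₁ atTop atTop →
      (∀ j, IsGroundStateInSector (hubbardTorusTT' (Ls₁ j) t s₁ U₂) (rectN n (Ls₁ j)) 0 (ψ₁ (Ls₁ j))) →
      (∀ j, star (ψ₁ (Ls₁ j)) ⬝ᵥ ψ₁ (Ls₁ j) = 1) → ω₁.IsTorusLimitOf ψ₁ Ls₁ →
      ω₁.meanEnergy (hubbardTTPrimeFermionInteraction 0 1 0) 1 ≤ A₁)
    (hB₂ : ∀ (ω₂ : InfVolFermionState 2) (Ls₂ : ℕ → ℕ) (ψ₂ : ∀ L, Fock (Orb (FermionTorus 2 L))),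
      Tendsto Ls₂ atTop atTop →
      (∀ j, IsGroundStateInSector (hubbardTorusTT' (Ls₂ j) t s₂ U₂) (rectN n (Ls₂ j)) 0 (ψ₂ (Ls₂ j))) →
      (∀ j, star (ψ₂ (Ls₂ j)) ⬝ᵥ ψ₂ (Ls₂ j) = 1) → ω₂.IsTorusLimitOf ψ₂ Ls₂ →
      B₂ ≤ ω₂.meanEnergy (hubbardTTPrimeFermionInteraction 0 1 0) 1)
    (hK : ∀ (s' U' : ℝ), s' ∈ Set.Icc s₁ s₂ → U' ∈ Set.Icc U₁ U₂ →
      ∀ (ω' : InfVolFermionState 2) (Ls' : ℕ → ℕ) (ψ' : ∀ L, Fock (Orb (FermionTorus 2 L))),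
      Tendsto Ls' atTop atTop →
      (∀ j, IsGroundStateInSector (hubbardTorusTT' (Ls' j) t s' U') (rectN n (Ls' j)) 0 (ψ' (Ls' j))) →
      (∀ j, star (ψ' (Ls' j)) ⬝ᵥ ψ' (Ls' j) = 1) → ω'.IsTorusLimitOf ψ' Ls' →
      ω'.meanEnergy (hubbardTTPrimeFermionInteraction 0 1 0) 1 ∈ Set.Icc BK AK)
    (hD : ∀ (s' U' : ℝ), s' ∈ Set.Icc s₁ s₂ → U' ∈ Set.Icc U₁ U₂ →
      ∀ (ω' : InfVolFermionState 2) (Ls' : ℕ → ℕ) (ψ' : ∀ L, Fock (Orb (FermionTorus 2 L))),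
      Tendsto Ls' atTop atTop →
      (∀ j, IsGroundStateInSector (hubbardTorusTT' (Ls' j) t s' U') (rectN n (Ls' j)) 0 (ψ' (Ls' j))) →
      (∀ j, star (ψ' (Ls' j)) ⬝ᵥ ψ' (Ls' j) = 1) → ω'.IsTorusLimitOf ψ' Ls' →
      ω'.meanEnergy (hubbardTTPrimeFermionInteraction 0 0 1) 1 ∈ Set.Icc BD AD)
    (hu : max (R₁ + (s₀ - s₁) * max A₁ AK) (R₂ - (s₂ - s₀) * min B₂ BK) + (U₀ - U₁) * max AD 0 ≤ u)
    {P : InfVolFermionState 2 → Prop}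
    (hP : ∀ (ω : InfVolFermionState 2) (Ls : ℕ → ℕ) (ψ : ∀ L, Fock (Orb (FermionTorus 2 L))),
      Tendsto Ls atTop atTop → (∀ j, IsNParticle (rectN n (Ls j)) (ψ (Ls j))) →
      (∀ j, star (ψ (Ls j)) ⬝ᵥ ψ (Ls j) = 1) → ω.IsTorusLimitOf ψ Ls →
      ω.meanEnergy (hubbardTTPrimeFermionInteraction t s₀ U₀) 1 ≤ u → P ω)
    {s U : ℝ} (hs : s ∈ Set.Icc s₁ s₂) (hUm : U ∈ Set.Icc U₁ U₂)
    {ω : InfVolFermionState 2} {ψ : ∀ L, Fock (Orb (FermionTorus 2 L))} {Ls : ℕ → ℕ}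
    (h : ω.IsTorusLimitOf ψ Ls) (hLs : Tendsto Ls atTop atTop)
    (hψ : ∀ j, IsGroundStateInSector (hubbardTorusTT' (Ls j) t s U) (rectN n (Ls j)) 0 (ψ (Ls j)))
    (h1 : ∀ j, star (ψ (Ls j)) ⬝ᵥ ψ (Ls j) = 1) : P ω := by
  have hN : ∀ j, IsNParticle (rectN n (Ls j)) (ψ (Ls j)) := fun j =>
    ((mem_szSector_iff _ _ _).1 (hψ j).1).1
  exact hP ω Ls ψ hLs hN h1 h
    ((h.meanEnergy_anchor₂_le_of_topCorners t hU₁ hU₀ hs hUm hn0 hn2 hR₁ hR₂ hA₁ hB₂ hK hD hLs hψ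
      h1).trans hu)

/-! ### §4 Cap-class WORDS with explicit cap slack on the cell (the `κ`-priced twins) -/

/-- **A κ-priced word on the `U`-segment above the anchor.** For `0 ≤ U₀ ≤ U ≤ U₂`, a cap `R` at
`(s, U₂)` and a real word certified at the anchor `(s, U₀)` with its cap slack explicit,
`c + κ·(u₀ − e_{Φ(t,s,U₀)}(ω)) ≤ f ω` on torus limits of unit `rectN n`-vectors (`κ ≥ 0`): every
torus-limit ground state `ω` at `(t,s,U)` has `c − κ·(R − u₀) ≤ f ω`.
[cite: WangEtAl2024, §III] [cite: KomaTasaki1994, §1] -/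
theorem IsTorusLimitOf.sub_mul_le_word_of_forall_capSlack_upperCap_U (t s : ℝ) {U₀ U U₂ : ℝ}
    (hU₀ : 0 ≤ U₀) (h0U : U₀ ≤ U) (hU2 : U ≤ U₂) {n : ℝ} (hn0 : 0 ≤ n) (hn2 : n < 2)
    {R u₀ κ c : ℝ} (hκ : 0 ≤ κ) (hR : energyDensityTT' t s U₂ n ≤ R)
    {f : InfVolFermionState 2 → ℝ}
    (hf : ∀ (ω : InfVolFermionState 2) (Ls : ℕ → ℕ) (ψ : ∀ L, Fock (Orb (FermionTorus 2 L))),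
      Tendsto Ls atTop atTop → (∀ j, IsNParticle (rectN n (Ls j)) (ψ (Ls j))) →
      (∀ j, star (ψ (Ls j)) ⬝ᵥ ψ (Ls j) = 1) → ω.IsTorusLimitOf ψ Ls →
      c + κ * (u₀ - ω.meanEnergy (hubbardTTPrimeFermionInteraction t s U₀) 1) ≤ f ω)
    {ω : InfVolFermionState 2} {ψ : ∀ L, Fock (Orb (FermionTorus 2 L))} {Ls : ℕ → ℕ}
    (h : ω.IsTorusLimitOf ψ Ls) (hLs : Tendsto Ls atTop atTop)
    (hψ : ∀ j, IsGroundStateInSector (hubbardTorusTT' (Ls j) t s U) (rectN n (Ls j)) 0 (ψ (Ls j)))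
    (h1 : ∀ j, star (ψ (Ls j)) ⬝ᵥ ψ (Ls j) = 1) :
    c - κ * (R - u₀) ≤ f ω := by
  have hN : ∀ j, IsNParticle (rectN n (Ls j)) (ψ (Ls j)) := fun j =>
    ((mem_szSector_iff _ _ _).1 (hψ j).1).1
  have hfω := hf ω Ls ψ hLs hN h1 h
  have hcap := h.meanEnergy_anchor_le_of_upperCap_U t s hU₀ h0U hU2 hn0 hn2 hR hLs hψ h1
  have hslack : -(R - u₀) ≤ u₀ - ω.meanEnergy (hubbardTTPrimeFermionInteraction t s U₀) 1 := by
    linarith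
  have hκs := mul_le_mul_of_nonneg_left hslack hκ
  linarith

/-- **A κ-priced word on the cell from the top-corner caps (kinematic).** Rectangle
`[s₁,s₂] × [U₁,U₂]` (`U₁ > 0`), anchor `(s₀, U₀)` with `U₀ ∈ [U₁,U₂]`, caps `R₁`, `R₂` at the top corners,
a word `c + κ·(u₀ − e_{Φ(t,s₀,U₀)}(ω)) ≤ f ω` certified at the anchor for the cap class (`κ ≥ 0`):
every torus-limit ground state `ω` at any `(s,U)` of the rectangle has
`c − κ·(max (R₁ + (16/π²)(s₀ − s₁)) (R₂ + (16/π²)(s₂ − s₀)) + (U₀ − U₁)(n/2)² − u₀) ≤ f ω`.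
[cite: WangEtAl2024, §III] [cite: LiebLoss1993, §8, Theorem 8.2] -/
theorem IsTorusLimitOf.sub_mul_le_word_of_forall_capSlack_topCaps_kinematic (t : ℝ)
    {s₁ s₂ U₁ U₂ s₀ U₀ s U : ℝ} (hU₁ : 0 < U₁) (hU₀ : U₀ ∈ Set.Icc U₁ U₂) (hs : s ∈ Set.Icc s₁ s₂)
    (hUm : U ∈ Set.Icc U₁ U₂) {n : ℝ} (hn0 : 0 ≤ n) (hn2 : n < 2) {R₁ R₂ u₀ κ c : ℝ} (hκ : 0 ≤ κ)
    (hR₁ : energyDensityTT' t s₁ U₂ n ≤ R₁) (hR₂ : energyDensityTT' t s₂ U₂ n ≤ R₂)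
    {f : InfVolFermionState 2 → ℝ}
    (hf : ∀ (ω : InfVolFermionState 2) (Ls : ℕ → ℕ) (ψ : ∀ L, Fock (Orb (FermionTorus 2 L))),
      Tendsto Ls atTop atTop → (∀ j, IsNParticle (rectN n (Ls j)) (ψ (Ls j))) →
      (∀ j, star (ψ (Ls j)) ⬝ᵥ ψ (Ls j) = 1) → ω.IsTorusLimitOf ψ Ls →
      c + κ * (u₀ - ω.meanEnergy (hubbardTTPrimeFermionInteraction t s₀ U₀) 1) ≤ f ω)
    {ω : InfVolFermionState 2} {ψ : ∀ L, Fock (Orb (FermionTorus 2 L))} {Ls : ℕ → ℕ}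
    (h : ω.IsTorusLimitOf ψ Ls) (hLs : Tendsto Ls atTop atTop)
    (hψ : ∀ j, IsGroundStateInSector (hubbardTorusTT' (Ls j) t s U) (rectN n (Ls j)) 0 (ψ (Ls j)))
    (h1 : ∀ j, star (ψ (Ls j)) ⬝ᵥ ψ (Ls j) = 1) :
    c - κ * (max (R₁ + 16 / Real.pi ^ 2 * (s₀ - s₁)) (R₂ + 16 / Real.pi ^ 2 * (s₂ - s₀)) +
      (U₀ - U₁) * (n / 2) ^ 2 - u₀) ≤ f ω := by
  have hN : ∀ j, IsNParticle (rectN n (Ls j)) (ψ (Ls j)) := fun j =>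
    ((mem_szSector_iff _ _ _).1 (hψ j).1).1
  have hfω := hf ω Ls ψ hLs hN h1 h
  have hcap := h.meanEnergy_anchor₂_le_of_topCaps_kinematic t (s₀ := s₀) hU₁ hU₀ hs hUm hn0 hn2 hR₁ hR₂
    hLs hψ h1
  have hslack : -(max (R₁ + 16 / Real.pi ^ 2 * (s₀ - s₁)) (R₂ + 16 / Real.pi ^ 2 * (s₂ - s₀)) +
      (U₀ - U₁) * (n / 2) ^ 2 - u₀) ≤
      u₀ - ω.meanEnergy (hubbardTTPrimeFermionInteraction t s₀ U₀) 1 := by linarith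
  have hκs := mul_le_mul_of_nonneg_left hslack hκ
  linarith

/-- **A κ-priced word on the cell from the top corners' caps and words (rectangle-uniform windows).**
Same data as `IsTorusLimitOf.meanEnergy_anchor₂_le_of_topCorners` plus the certified word with explicit
slack at the anchor: every torus-limit ground state `ω` at any `(s,U)` of the rectangle has
`c − κ·(max (R₁ + (s₀ − s₁)·max A₁ A_K) (R₂ − (s₂ − s₀)·min B₂ B_K) + (U₀ − U₁)·max A_D 0 − u₀) ≤ f ω`.
[cite: WangEtAl2024, §III] [cite: KomaTasaki1994, §1] -/
theorem IsTorusLimitOf.sub_mul_le_word_of_forall_capSlack_topCorners (t : ℝ)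
    {s₁ s₂ U₁ U₂ s₀ U₀ s U : ℝ} (hU₁ : 0 ≤ U₁) (hU₀ : U₀ ∈ Set.Icc U₁ U₂) (hs : s ∈ Set.Icc s₁ s₂)
    (hUm : U ∈ Set.Icc U₁ U₂) {n : ℝ} (hn0 : 0 ≤ n) (hn2 : n < 2)
    {R₁ R₂ A₁ B₂ AK BK AD BD u₀ κ c : ℝ} (hκ : 0 ≤ κ)
    (hR₁ : energyDensityTT' t s₁ U₂ n ≤ R₁) (hR₂ : energyDensityTT' t s₂ U₂ n ≤ R₂)
    (hA₁ : ∀ (ω₁ : InfVolFermionState 2) (Ls₁ : ℕ → ℕ) (ψ₁ : ∀ L, Fock (Orb (FermionTorus 2 L))),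
      Tendsto Ls₁ atTop atTop →
      (∀ j, IsGroundStateInSector (hubbardTorusTT' (Ls₁ j) t s₁ U₂) (rectN n (Ls₁ j)) 0 (ψ₁ (Ls₁ j))) →
      (∀ j, star (ψ₁ (Ls₁ j)) ⬝ᵥ ψ₁ (Ls₁ j) = 1) → ω₁.IsTorusLimitOf ψ₁ Ls₁ →
      ω₁.meanEnergy (hubbardTTPrimeFermionInteraction 0 1 0) 1 ≤ A₁)
    (hB₂ : ∀ (ω₂ : InfVolFermionState 2) (Ls₂ : ℕ → ℕ) (ψ₂ : ∀ L, Fock (Orb (FermionTorus 2 L))),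
      Tendsto Ls₂ atTop atTop →
      (∀ j, IsGroundStateInSector (hubbardTorusTT' (Ls₂ j) t s₂ U₂) (rectN n (Ls₂ j)) 0 (ψ₂ (Ls₂ j))) →
      (∀ j, star (ψ₂ (Ls₂ j)) ⬝ᵥ ψ₂ (Ls₂ j) = 1) → ω₂.IsTorusLimitOf ψ₂ Ls₂ →
      B₂ ≤ ω₂.meanEnergy (hubbardTTPrimeFermionInteraction 0 1 0) 1)
    (hK : ∀ (s' U' : ℝ), s' ∈ Set.Icc s₁ s₂ → U' ∈ Set.Icc U₁ U₂ →
      ∀ (ω' : InfVolFermionState 2) (Ls' : ℕ → ℕ) (ψ' : ∀ L, Fock (Orb (FermionTorus 2 L))),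
      Tendsto Ls' atTop atTop →
      (∀ j, IsGroundStateInSector (hubbardTorusTT' (Ls' j) t s' U') (rectN n (Ls' j)) 0 (ψ' (Ls' j))) →
      (∀ j, star (ψ' (Ls' j)) ⬝ᵥ ψ' (Ls' j) = 1) → ω'.IsTorusLimitOf ψ' Ls' →
      ω'.meanEnergy (hubbardTTPrimeFermionInteraction 0 1 0) 1 ∈ Set.Icc BK AK)
    (hD : ∀ (s' U' : ℝ), s' ∈ Set.Icc s₁ s₂ → U' ∈ Set.Icc U₁ U₂ →
      ∀ (ω' : InfVolFermionState 2) (Ls' : ℕ → ℕ) (ψ' : ∀ L, Fock (Orb (FermionTorus 2 L))),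
      Tendsto Ls' atTop atTop →
      (∀ j, IsGroundStateInSector (hubbardTorusTT' (Ls' j) t s' U') (rectN n (Ls' j)) 0 (ψ' (Ls' j))) →
      (∀ j, star (ψ' (Ls' j)) ⬝ᵥ ψ' (Ls' j) = 1) → ω'.IsTorusLimitOf ψ' Ls' →
      ω'.meanEnergy (hubbardTTPrimeFermionInteraction 0 0 1) 1 ∈ Set.Icc BD AD)
    {f : InfVolFermionState 2 → ℝ}
    (hf : ∀ (ω : InfVolFermionState 2) (Ls : ℕ → ℕ) (ψ : ∀ L, Fock (Orb (FermionTorus 2 L))),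
      Tendsto Ls atTop atTop → (∀ j, IsNParticle (rectN n (Ls j)) (ψ (Ls j))) →
      (∀ j, star (ψ (Ls j)) ⬝ᵥ ψ (Ls j) = 1) → ω.IsTorusLimitOf ψ Ls →
      c + κ * (u₀ - ω.meanEnergy (hubbardTTPrimeFermionInteraction t s₀ U₀) 1) ≤ f ω)
    {ω : InfVolFermionState 2} {ψ : ∀ L, Fock (Orb (FermionTorus 2 L))} {Ls : ℕ → ℕ}
    (h : ω.IsTorusLimitOf ψ Ls) (hLs : Tendsto Ls atTop atTop)
    (hψ : ∀ j, IsGroundStateInSector (hubbardTorusTT' (Ls j) t s U) (rectN n (Ls j)) 0 (ψ (Ls j)))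
    (h1 : ∀ j, star (ψ (Ls j)) ⬝ᵥ ψ (Ls j) = 1) :
    c - κ * (max (R₁ + (s₀ - s₁) * max A₁ AK) (R₂ - (s₂ - s₀) * min B₂ BK) +
      (U₀ - U₁) * max AD 0 - u₀) ≤ f ω := by
  have hN : ∀ j, IsNParticle (rectN n (Ls j)) (ψ (Ls j)) := fun j =>
    ((mem_szSector_iff _ _ _).1 (hψ j).1).1
  have hfω := hf ω Ls ψ hLs hN h1 h
  have hcap := h.meanEnergy_anchor₂_le_of_topCorners t (s₀ := s₀) hU₁ hU₀ hs hUm hn0 hn2 hR₁ hR₂ hA₁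
    hB₂ hK hD hLs hψ h1
  have hslack : -(max (R₁ + (s₀ - s₁) * max A₁ AK) (R₂ - (s₂ - s₀) * min B₂ BK) +
      (U₀ - U₁) * max AD 0 - u₀) ≤
      u₀ - ω.meanEnergy (hubbardTTPrimeFermionInteraction t s₀ U₀) 1 := by linarith
  have hκs := mul_le_mul_of_nonneg_left hslack hκ
  linarith

end InfVolFermionState

end Literature.MathematicalPhysics.QuantumLattice

end
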